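import Mathlib
import HarnessLib
import Literature.MathematicalPhysics.QuantumLattice.HubbardSliceSymbolBandIncrementChainXi4
import Literature.MathematicalPhysics.QuantumLattice.HubbardSliceSymbolBandIncrementChainLow
import Summits.HubbardSuperconductivity.HubbardSuperconductivity.Theorems.KLProgrammeKLRegimeSliceSymbolLineThree

/-!
# Route `KLProgramme` — engine support (route (L2), weighted lines, cure (c-D)): the INCREMENT of the slice propagator symbol across one frame
# piece, `p ↦ Ψ̂_ω(b p + v p) − Ψ̂_ω(b p)`, along lattice lines — sup and differences of orders `1, 2, 3`, every term carrying the piece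

Cell `gate-hubbard-kl`, seat hubbard-kl-k3c3-p2 (g8), for the ENGINE child stmt-HubbardSuperconductivity-20437 (`stub_engine_step_norms`: the WEIGHTED
lines `KernelNormsWt4 … K_n j` at internal levels, v2 conditional token #19 `klWtBudget ↦ klWtBudget·klWtAllow`; located risk «(b)-Wt@j≥1», evidence
#48 CD-LIMITS).  The flow-piece telescoping of the weighted slice rows at `(K_n, j)` writes the slice symbol through the frame `K_n = K_{m₀} − Σ_m p_m` as
`Ψ̂∘e_{K_{m₀}} + Σ_m [Ψ̂∘(e_m + p_m) − Ψ̂∘e_m]` (`e_{m+1} = e_m + p_m`, Benfatto–Giuliani–Mastropietro 2006 §3 (3.2)–(3.8)); the `m`-th increment is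
read by the mixed master lemma through its sup and its differences of orders `≤ 3` along lattice lines, ALL of which carry a factor of the piece
(`|v| ≤ P₀`, `‖Dv‖ ≤ P₁`, `‖D²v‖ ≤ P₂`, `‖D³v‖ ≤ P₃`) against the band's `‖Db‖ ≤ K₁ᵇ`, `‖D²b‖ ≤ K₂ᵇ`, `‖D³b‖ ≤ K₃ᵇ` (isotropic data suffice for the
increments: the piece's smallness beats the lost anisotropy, CD-LIMITS §1).  This file is the continuum LINE layer (Literature's increment chain
`HubbardSliceSymbolBandIncrementChain{,Low,Xi4}` on the restrictions `s ↦ b(q + s•w)`, `s ↦ v(q + s•w)`):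

* §1 `abs_fderiv_apply_le_of_opNorm_le` and the line chains with GLOBAL bounds (`lineChain_bounds`);
* §2 **`norm_sliceSymbol_incr_le`** (sup `≤ K₁^Ψ P₀`), **`norm_fwdDiff_sliceSymbol_incr_line_le`**, **`norm_fwdDiff_two_sliceSymbol_incr_line_le`**,
  **`norm_fwdDiff_three_sliceSymbol_incr_line_le`** — `‖Δ_w^k[p ↦ Ψ̂_ω(b p + v p) − Ψ̂_ω(b p)](q)‖` bounded by the explicit polynomials of
  `HubbardSliceSymbolBandIncrementChain{Low,Xi4}` at `D_i = K_iᵇ‖w‖ⁱ`, `W₀ = P₀`, `W_i = P_i‖w‖ⁱ` (`K₁^Ψ = (16B₁+16)c/Λ²`, …, `K₄^Ψ = (128B₄+…)c/Λ⁵`).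

Everything is proved; no definitions, no named facts. [folklore]

References: G. Benfatto, A. Giuliani, V. Mastropietro, Ann. Henri Poincaré 7 (2006) 809–898, (2.36aa), §3 (3.2)–(3.8); M. Salmhofer, *Renormalization*
(1999), §4.2.5 (4.70)–(4.71).
-/

noncomputable section

namespace Summit.HubbardSuperconductivity.HubbardSuperconductivity.Theorems.TorusFourierL2

set_option linter.dupNamespace false -- summit = problem name (single-conjunct summit), D-0017

open Set Complex Literature.MathematicalPhysics.QuantumLattice Literature.Probability.LatticeModels Literature.Analysis.Calculus

section Line

variable {V : Type*} [NormedAddCommGroup V] [NormedSpace ℝ V] {c Λ Λ' ω : ℝ}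

/-- `|Df(x)·w| ≤ K‖w‖` from `‖Df‖ ≤ K`. [folklore] -/
theorem abs_fderiv_apply_le_of_opNorm_le {f : V → ℝ} {K : ℝ} (hK : ∀ p, ‖fderiv ℝ f p‖ ≤ K) (x w : V) : |fderiv ℝ f x w| ≤ K * ‖w‖ := by
  rw [← Real.norm_eq_abs]
  exact (ContinuousLinearMap.le_opNorm _ _).trans (mul_le_mul_of_nonneg_right (hK x) (norm_nonneg _))

omit [NormedAddCommGroup V] [NormedSpace ℝ V] in
/-- **The sup of the increment**: `‖Ψ̂_ω(b q + v q) − Ψ̂_ω(b q)‖ ≤ (16B₁+16)(c/Λ²)·P₀` when `|v| ≤ P₀`. [cite: BenfattoGiulianiMastropietro2006, §3 (3.2)] -/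
theorem norm_sliceSymbol_incr_le (hΛ : 0 < Λ) (hΛΛ' : Λ ≤ Λ') (hc : 0 ≤ c) {B₁ : ℝ} (hB₁ : ∀ x, |deriv salmhoferCutoff x| ≤ B₁)
    {b v : V → ℝ} {P₀ : ℝ} (hv₀ : ∀ p, |v p| ≤ P₀) (q : V) :
    ‖sliceSymbolFnXi c 0 Λ Λ' ω (b q + v q) - sliceSymbolFnXi c 0 Λ Λ' ω (b q)‖ ≤ (16 * B₁ + 16) * c / Λ ^ 2 * P₀ := by
  have hB10 : 0 ≤ B₁ := (abs_nonneg _).trans (hB₁ 0)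
  exact (norm_sliceSymbolFnXi_sub_le hΛ hΛΛ' (abs_zero_le_quarter hΛ) hc hB₁ (b q) (v q)).trans
    (mul_le_mul_of_nonneg_left (hv₀ q) (by positivity))

/-- **First difference of the increment along a lattice line**:
`‖Δ_w[p ↦ Ψ̂(b p + v p) − Ψ̂(b p)](q)‖ ≤ K₂^Ψ·P₀·(K₁ᵇ‖w‖ + P₁‖w‖) + K₁^Ψ·P₁‖w‖`. [cite: BenfattoGiulianiMastropietro2006, §3 (3.2)] -/
theorem norm_fwdDiff_sliceSymbol_incr_line_le {b v : V → ℝ} (hb : ContDiff ℝ 3 b) (hv : ContDiff ℝ 3 v) {Kb₁ P₀ P₁ : ℝ}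
    (hb₁ : ∀ p, ‖fderiv ℝ b p‖ ≤ Kb₁) (hv₀ : ∀ p, |v p| ≤ P₀) (hv₁ : ∀ p, ‖fderiv ℝ v p‖ ≤ P₁)
    (hΛ : 0 < Λ) (hΛΛ' : Λ ≤ Λ') (hc : 0 ≤ c) {B₁ B₂ : ℝ} (hB₁ : ∀ x, |deriv salmhoferCutoff x| ≤ B₁)
    (hB₂ : ∀ x, |deriv (deriv salmhoferCutoff) x| ≤ B₂) (q w : V) :
    ‖fwdDiff w (fun p => sliceSymbolFnXi c 0 Λ Λ' ω (b p + v p) - sliceSymbolFnXi c 0 Λ Λ' ω (b p)) q‖ ≤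
      (32 * B₂ + 144 * B₁ + 128) * c / Λ ^ 3 * P₀ * (Kb₁ * ‖w‖ + P₁ * ‖w‖) + (16 * B₁ + 16) * c / Λ ^ 2 * (P₁ * ‖w‖) := by
  have hb2 : ContDiff ℝ 2 b := hb.of_le (by norm_num)
  have hv2 : ContDiff ℝ 2 v := hv.of_le (by norm_num)
  have e0 := Literature.Analysis.Calculus.fwdDiff_iter_apply_add_smul q w 1
    (fun p => sliceSymbolFnXi c 0 Λ Λ' ω (b p + v p) - sliceSymbolFnXi c 0 Λ Λ' ω (b p)) 0
  rw [zero_smul, add_zero, Function.iterate_one, Function.iterate_one] at e0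
  rw [e0]
  have h := norm_fwdDiff_sliceSymbolFnXi_incr_le (c := c) (ω := ω) hΛ hΛΛ' (abs_zero_le_quarter hΛ) hc hB₁ hB₂
    (u := fun s : ℝ => b (q + s • w)) (u₁ := fun s : ℝ => fderiv ℝ b (q + s • w) w)
    (w := fun s : ℝ => v (q + s • w)) (w₁ := fun s : ℝ => fderiv ℝ v (q + s • w) w)
    (fun t => hasDerivAt_line hb2 q w t) (fun t => hasDerivAt_line hv2 q w t)
    (D₁ := Kb₁ * ‖w‖) (W₀ := P₀) (W₁ := P₁ * ‖w‖)
    (fun t => abs_fderiv_apply_le_of_opNorm_le hb₁ _ _) (fun t => hv₀ _) (fun t => abs_fderiv_apply_le_of_opNorm_le hv₁ _ _) zero_le_one 0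
  simpa only [one_mul] using h

/-- **Second difference of the increment along a lattice line** (`D_i = K_iᵇ‖w‖ⁱ`, `W_i = P_i‖w‖ⁱ`):
`≤ K₃^ΨP₀(D₁+W₁)² + K₂^ΨW₁(2D₁+W₁) + K₂^ΨP₀(D₂+W₂) + K₁^ΨW₂`. [cite: BenfattoGiulianiMastropietro2006, §3 (3.2)] -/
theorem norm_fwdDiff_two_sliceSymbol_incr_line_le {b v : V → ℝ} (hb : ContDiff ℝ 3 b) (hv : ContDiff ℝ 3 v) {Kb₁ Kb₂ P₀ P₁ P₂ : ℝ}
    (hb₁ : ∀ p, ‖fderiv ℝ b p‖ ≤ Kb₁) (hb₂ : ∀ p, ‖iteratedFDeriv ℝ 2 b p‖ ≤ Kb₂)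
    (hv₀ : ∀ p, |v p| ≤ P₀) (hv₁ : ∀ p, ‖fderiv ℝ v p‖ ≤ P₁) (hv₂ : ∀ p, ‖iteratedFDeriv ℝ 2 v p‖ ≤ P₂)
    (hΛ : 0 < Λ) (hΛΛ' : Λ ≤ Λ') (hc : 0 ≤ c) {B₁ B₂ B₃ : ℝ} (hB₁ : ∀ x, |deriv salmhoferCutoff x| ≤ B₁)
    (hB₂ : ∀ x, |deriv (deriv salmhoferCutoff) x| ≤ B₂) (hB₃ : ∀ x, |deriv (deriv (deriv salmhoferCutoff)) x| ≤ B₃) (q w : V) :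
    ‖(fwdDiff w)^[2] (fun p => sliceSymbolFnXi c 0 Λ Λ' ω (b p + v p) - sliceSymbolFnXi c 0 Λ Λ' ω (b p)) q‖ ≤
      (64 * B₃ + 480 * B₂ + 1728 * B₁ + 1536) * c / Λ ^ 4 * P₀ * (Kb₁ * ‖w‖ + P₁ * ‖w‖) ^ 2 +
        (32 * B₂ + 144 * B₁ + 128) * c / Λ ^ 3 * (P₁ * ‖w‖ * (2 * (Kb₁ * ‖w‖) + P₁ * ‖w‖)) +
        ((32 * B₂ + 144 * B₁ + 128) * c / Λ ^ 3 * P₀ * (Kb₂ * ‖w‖ ^ 2 + P₂ * ‖w‖ ^ 2) +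
          (16 * B₁ + 16) * c / Λ ^ 2 * (P₂ * ‖w‖ ^ 2)) := by
  have hb2 : ContDiff ℝ 2 b := hb.of_le (by norm_num)
  have hv2 : ContDiff ℝ 2 v := hv.of_le (by norm_num)
  have e0 := Literature.Analysis.Calculus.fwdDiff_iter_apply_add_smul q w 2
    (fun p => sliceSymbolFnXi c 0 Λ Λ' ω (b p + v p) - sliceSymbolFnXi c 0 Λ Λ' ω (b p)) 0
  rw [zero_smul, add_zero] at e0
  rw [e0]
  have h := norm_fwdDiff_iter_two_sliceSymbolFnXi_incr_le (c := c) (ω := ω) hΛ hΛΛ' (abs_zero_le_quarter hΛ) hc hB₁ hB₂ hB₃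
    (u := fun s : ℝ => b (q + s • w)) (u₁ := fun s : ℝ => fderiv ℝ b (q + s • w) w)
    (u₂ := fun s : ℝ => iteratedDeriv 2 (fun s : ℝ => b (q + s • w)) s)
    (w := fun s : ℝ => v (q + s • w)) (w₁ := fun s : ℝ => fderiv ℝ v (q + s • w) w)
    (w₂ := fun s : ℝ => iteratedDeriv 2 (fun s : ℝ => v (q + s • w)) s)
    (fun t => hasDerivAt_line hb2 q w t) (fun t => hasDerivAt_line_deriv hb2 q w t)
    (fun t => hasDerivAt_line hv2 q w t) (fun t => hasDerivAt_line_deriv hv2 q w t)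
    (D₁ := Kb₁ * ‖w‖) (D₂ := Kb₂ * ‖w‖ ^ 2) (W₀ := P₀) (W₁ := P₁ * ‖w‖) (W₂ := P₂ * ‖w‖ ^ 2)
    (fun t => abs_fderiv_apply_le_of_opNorm_le hb₁ _ _) (fun t => abs_iteratedDeriv_two_line_le hb2 hb₂ q w t) (fun t => hv₀ _)
    (fun t => abs_fderiv_apply_le_of_opNorm_le hv₁ _ _) (fun t => abs_iteratedDeriv_two_line_le hv2 hv₂ q w t) zero_le_one 0
  simpa only [one_pow, one_mul] using h

/-- **Third difference of the increment along a lattice line** (`D_i = K_iᵇ‖w‖ⁱ`, `W_i = P_i‖w‖ⁱ`, all four slice-symbol constants explicit):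
`≤ K₄^ΨP₀(D₁+W₁)³ + K₃^ΨW₁(3D₁²+3D₁W₁+W₁²) + 3(K₃^ΨP₀(D₁+W₁)(D₂+W₂) + K₂^Ψ(D₁W₂+W₁D₂+W₁W₂)) + K₂^ΨP₀(D₃+W₃) + K₁^ΨW₃`.
[cite: BenfattoGiulianiMastropietro2006, §3 (3.2)] -/
theorem norm_fwdDiff_three_sliceSymbol_incr_line_le {b v : V → ℝ} (hb : ContDiff ℝ 3 b) (hv : ContDiff ℝ 3 v) {Kb₁ Kb₂ Kb₃ P₀ P₁ P₂ P₃ : ℝ}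
    (hb₁ : ∀ p, ‖fderiv ℝ b p‖ ≤ Kb₁) (hb₂ : ∀ p, ‖iteratedFDeriv ℝ 2 b p‖ ≤ Kb₂) (hb₃ : ∀ p, ‖iteratedFDeriv ℝ 3 b p‖ ≤ Kb₃)
    (hv₀ : ∀ p, |v p| ≤ P₀) (hv₁ : ∀ p, ‖fderiv ℝ v p‖ ≤ P₁) (hv₂ : ∀ p, ‖iteratedFDeriv ℝ 2 v p‖ ≤ P₂)
    (hv₃ : ∀ p, ‖iteratedFDeriv ℝ 3 v p‖ ≤ P₃)
    (hΛ : 0 < Λ) (hΛΛ' : Λ ≤ Λ') (hc : 0 ≤ c) {B₁ B₂ B₃ B₄ : ℝ} (hB₁ : ∀ x, |deriv salmhoferCutoff x| ≤ B₁)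
    (hB₂ : ∀ x, |deriv (deriv salmhoferCutoff) x| ≤ B₂) (hB₃ : ∀ x, |deriv (deriv (deriv salmhoferCutoff)) x| ≤ B₃)
    (hB₄ : ∀ x, |deriv (deriv (deriv (deriv salmhoferCutoff))) x| ≤ B₄) (q w : V) :
    ‖(fwdDiff w)^[3] (fun p => sliceSymbolFnXi c 0 Λ Λ' ω (b p + v p) - sliceSymbolFnXi c 0 Λ Λ' ω (b p)) q‖ ≤
      (128 * B₄ + 1408 * B₃ + 7776 * B₂ + 27648 * B₁ + 24576) * c / Λ ^ 5 * P₀ * (Kb₁ * ‖w‖ + P₁ * ‖w‖) ^ 3 +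
        (64 * B₃ + 480 * B₂ + 1728 * B₁ + 1536) * c / Λ ^ 4 *
          (P₁ * ‖w‖ * (3 * (Kb₁ * ‖w‖) ^ 2 + 3 * (Kb₁ * ‖w‖) * (P₁ * ‖w‖) + (P₁ * ‖w‖) ^ 2)) +
        3 * ((64 * B₃ + 480 * B₂ + 1728 * B₁ + 1536) * c / Λ ^ 4 * P₀ * ((Kb₁ * ‖w‖ + P₁ * ‖w‖) * (Kb₂ * ‖w‖ ^ 2 + P₂ * ‖w‖ ^ 2)) +
          (32 * B₂ + 144 * B₁ + 128) * c / Λ ^ 3 *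
            (Kb₁ * ‖w‖ * (P₂ * ‖w‖ ^ 2) + P₁ * ‖w‖ * (Kb₂ * ‖w‖ ^ 2) + P₁ * ‖w‖ * (P₂ * ‖w‖ ^ 2))) +
        ((32 * B₂ + 144 * B₁ + 128) * c / Λ ^ 3 * P₀ * (Kb₃ * ‖w‖ ^ 3 + P₃ * ‖w‖ ^ 3) +
          (16 * B₁ + 16) * c / Λ ^ 2 * (P₃ * ‖w‖ ^ 3)) := by
  have hb2 : ContDiff ℝ 2 b := hb.of_le (by norm_num)
  have hv2 : ContDiff ℝ 2 v := hv.of_le (by norm_num)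
  have e0 := Literature.Analysis.Calculus.fwdDiff_iter_apply_add_smul q w 3
    (fun p => sliceSymbolFnXi c 0 Λ Λ' ω (b p + v p) - sliceSymbolFnXi c 0 Λ Λ' ω (b p)) 0
  rw [zero_smul, add_zero] at e0
  rw [e0]
  have h := norm_fwdDiff_iter_three_sliceSymbolFnXi_incr_le_explicit (c := c) (ω := ω) hΛ hΛΛ' (abs_zero_le_quarter hΛ) hc hB₁ hB₂ hB₃ hB₄
    (u := fun s : ℝ => b (q + s • w)) (u₁ := fun s : ℝ => fderiv ℝ b (q + s • w) w)
    (u₂ := fun s : ℝ => iteratedDeriv 2 (fun s : ℝ => b (q + s • w)) s) (u₃ := fun s : ℝ => iteratedDeriv 3 (fun s : ℝ => b (q + s • w)) s)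
    (w := fun s : ℝ => v (q + s • w)) (w₁ := fun s : ℝ => fderiv ℝ v (q + s • w) w)
    (w₂ := fun s : ℝ => iteratedDeriv 2 (fun s : ℝ => v (q + s • w)) s) (w₃ := fun s : ℝ => iteratedDeriv 3 (fun s : ℝ => v (q + s • w)) s)
    (fun t => hasDerivAt_line hb2 q w t) (fun t => hasDerivAt_line_deriv hb2 q w t) (fun t => hasDerivAt_line_deriv_two hb q w t)
    (fun t => hasDerivAt_line hv2 q w t) (fun t => hasDerivAt_line_deriv hv2 q w t) (fun t => hasDerivAt_line_deriv_two hv q w t)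
    (D₁ := Kb₁ * ‖w‖) (D₂ := Kb₂ * ‖w‖ ^ 2) (D₃ := Kb₃ * ‖w‖ ^ 3) (W₀ := P₀) (W₁ := P₁ * ‖w‖) (W₂ := P₂ * ‖w‖ ^ 2) (W₃ := P₃ * ‖w‖ ^ 3)
    (fun t => abs_fderiv_apply_le_of_opNorm_le hb₁ _ _) (fun t => abs_iteratedDeriv_two_line_le hb2 hb₂ q w t)
    (fun t => abs_iteratedDeriv_three_line_le hb hb₃ q w t) (fun t => hv₀ _)
    (fun t => abs_fderiv_apply_le_of_opNorm_le hv₁ _ _) (fun t => abs_iteratedDeriv_two_line_le hv2 hv₂ q w t)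
    (fun t => abs_iteratedDeriv_three_line_le hv hv₃ q w t) zero_le_one 0
  simpa only [one_pow, one_mul] using h

end Line

end Summit.HubbardSuperconductivity.HubbardSuperconductivity.Theorems.TorusFourierL2

end
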